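import Literature.RingTheory.MvPolynomial.RuppertGaoReduction
import Literature.RingTheory.MvPolynomial.OstrowskiNorms
import Literature.RingTheory.MvPolynomial.NoetherFormsToolkit
import Literature.RingTheory.MvPolynomial.AbsoluteIrreducibilityReductionProofs
import Summits.ValiantsHypothesis.ValiantsHypothesis.Theorems.LangWeilTransferGoodReductionAbsIrreducible

/-!
# LangWeilTransfer, support item `GoodReduction` (stmt-ValiantsHypothesis-6377) — the size of
# the integer minor

Helper for the general case of `GoodReduction`: the minors of Ruppert's matrix of the generic plane
section `planeSect Q ∈ (ℤ[z, μ, v])[X, Y]` of `Q ∈ ℤ[x_0..x_m]` (total degree `d`, weight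
`W = Σ |coeff|`) have integer coefficients of controlled size: every coefficient (in `ℤ[z, μ, v]`)
of `planeSect Q` has `ℓ¹`-norm `≤ 3^d W`, every entry of Ruppert's matrix has `ℓ¹`-norm
`≤ 2 d 3^d W`, and a minor of size `k` has `ℓ¹`-norm `≤ k! (2 d 3^d W)^k`; so the number of primes
dividing one coefficient of such a minor is polynomial in `d` and `log W`. Honest framing:
bookkeeping for a dormant conditional route; nothing here bears on VP ≠ VNP.
-/

noncomputable section

open MvPolynomial

-- the summit and the problem share the name `ValiantsHypothesis` (D-0017 single-conjunct layout)
set_option linter.dupNamespace false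

namespace Summit.ValiantsHypothesis.ValiantsHypothesis.Theorems.LangWeilTransfer

open Literature.RingTheory.MvPolynomial
open Literature.RingTheory.MvPolynomial.Ruppert
open Literature.RingTheory.MvPolynomial.NoetherForms
open Literature.Computability.AlgebraicComplexity (weight)

variable {n : ℕ}

/-! ## The `ℓ¹`-norm of a determinant -/

/-- `‖det M‖₁ ≤ k! · E^k` when every entry has `‖·‖₁ ≤ E`. -/
theorem l1Norm_det_le {τ : Type*} {k : ℕ} (M : Matrix (Fin k) (Fin k) (MvPolynomial τ ℤ)) (E : ℕ)
    (hM : ∀ i j, l1Norm (M i j) ≤ E) : l1Norm M.det ≤ k.factorial * E ^ k := by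
  classical
  rw [Matrix.det_apply']
  refine (l1Norm_sum_le _ _).trans ?_
  calc ∑ π : Equiv.Perm (Fin k), l1Norm (((Equiv.Perm.sign π : ℤ) : MvPolynomial τ ℤ) * ∏ i, M (π i) i)
        ≤ ∑ _π : Equiv.Perm (Fin k), E ^ k := by
          refine Finset.sum_le_sum fun π _ => ?_
          rw [← map_intCast (C : ℤ →+* MvPolynomial τ ℤ), Int.cast_id]
          refine (l1Norm_mul_le _ _).trans ?_
          rw [l1Norm_C, Int.units_natAbs, one_mul]
          refine (l1Norm_prod_le _ _).trans ?_
          calc ∏ i, l1Norm (M (π i) i) ≤ ∏ _i : Fin k, E := Finset.prod_le_prod' fun i _ => hM _ _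
            _ = E ^ k := by rw [Finset.prod_const, Finset.card_univ, Fintype.card_fin]
    _ = k.factorial * E ^ k := by
          rw [Finset.sum_const, Finset.card_univ, Fintype.card_perm, Fintype.card_fin, smul_eq_mul]

/-! ## The coefficients of the generic section -/

/-- Read in `ℤ[z, μ, v][Y][X]`, the generic section is `Q(μ + vX + zY)`. -/
theorem finTwoEquiv_planeSect (Q : MvPolynomial (Fin n) ℤ) :
    finTwoEquiv _ (planeSect Q) = MvPolynomial.aeval (fun i ↦
      (Polynomial.C (Polynomial.C (X (Sum.inr (Sum.inl i)))) +
        Polynomial.C (Polynomial.C (X (Sum.inr (Sum.inr i)))) * Polynomial.X +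
        Polynomial.C (Polynomial.C (X (Sum.inl i)) * Polynomial.X) :
          Polynomial (Polynomial (MvPolynomial (Params n) ℤ)))) Q := by
  have key : ((finTwoEquiv (MvPolynomial (Params n) ℤ) :
      MvPolynomial (Fin 2) (MvPolynomial (Params n) ℤ) →+* Polynomial (Polynomial (MvPolynomial (Params n) ℤ))).comp
      (eval₂Hom (C.comp C) (sectSubst (A := ℤ) n))) =
      (MvPolynomial.aeval (fun i ↦
        (Polynomial.C (Polynomial.C (X (Sum.inr (Sum.inl i)))) +
          Polynomial.C (Polynomial.C (X (Sum.inr (Sum.inr i)))) * Polynomial.X +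
          Polynomial.C (Polynomial.C (X (Sum.inl i)) * Polynomial.X) :
            Polynomial (Polynomial (MvPolynomial (Params n) ℤ))))).toRingHom := by
    refine MvPolynomial.ringHom_ext (fun a => ?_) (fun i => ?_)
    · simp only [RingHom.coe_comp, Function.comp_apply, eval₂Hom_C, AlgHom.toRingHom_eq_coe,
        RingHom.coe_coe, MvPolynomial.algHom_C, Polynomial.algebraMap_apply, MvPolynomial.algebraMap_eq]
      exact finTwoEquiv_C _ _
    · simp only [RingHom.coe_comp, Function.comp_apply, eval₂Hom_X', AlgHom.toRingHom_eq_coe,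
        RingHom.coe_coe, MvPolynomial.aeval_X, sectSubst, map_add, map_mul,
        finTwoEquiv_C, finTwoEquiv_X_zero, finTwoEquiv_X_one]
  exact DFunLike.congr_fun key Q

/-- **Every coefficient of the generic section has `ℓ¹`-norm `≤ 3^d · W`.** -/
theorem l1Norm_coeff_planeSect_le (Q : MvPolynomial (Fin n) ℤ) (m : Fin 2 →₀ ℕ) :
    l1Norm ((planeSect Q).coeff m) ≤ 3 ^ Q.totalDegree * weight Q := by
  classical
  -- the two-level weighted `ℓ¹` seminorm
  set N1 : RingSeminorm (Polynomial (MvPolynomial (Params n) ℤ)) :=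
    (l1Seminorm (Params n)).polynomial 1 zero_le_one with hN1
  set N2 : RingSeminorm (Polynomial (Polynomial (MvPolynomial (Params n) ℤ))) :=
    N1.polynomial 1 zero_le_one with hN2
  have hN1one : N1 1 ≤ 1 := by
    rw [hN1, RingSeminorm.polynomial_apply, polyNorm_one, l1Seminorm_one]
  have hN2_CC : ∀ a : MvPolynomial (Params n) ℤ, N2 (Polynomial.C (Polynomial.C a)) = l1Norm a := by
    intro a
    rw [hN2, RingSeminorm.polynomial_apply, polyNorm_C, hN1, RingSeminorm.polynomial_apply, polyNorm_C,
      l1Seminorm_apply]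
  have hN2_X : N2 Polynomial.X ≤ 1 := by
    rw [hN2, RingSeminorm.polynomial_apply, ← Polynomial.monomial_one_one_eq_X, polyNorm_monomial,
      one_pow, mul_one]
    exact hN1one
  have hN2_CX : ∀ a : MvPolynomial (Params n) ℤ,
      N2 (Polynomial.C (Polynomial.C a * Polynomial.X)) = l1Norm a := by
    intro a
    rw [hN2, RingSeminorm.polynomial_apply, polyNorm_C, hN1, RingSeminorm.polynomial_apply,
      ← Polynomial.monomial_zero_left, Polynomial.monomial_mul_X, polyNorm_monomial, l1Seminorm_apply,
      one_pow, mul_one]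
  -- the images of the variables have norm `≤ 3`
  have hgen : ∀ i : Fin n, N2 (Polynomial.C (Polynomial.C (X (Sum.inr (Sum.inl i)))) +
      Polynomial.C (Polynomial.C (X (Sum.inr (Sum.inr i)))) * Polynomial.X +
      Polynomial.C (Polynomial.C (X (Sum.inl i)) * Polynomial.X) :
        Polynomial (Polynomial (MvPolynomial (Params n) ℤ))) ≤ 3 := by
    intro i
    refine (map_add_le_add N2 _ _).trans ?_
    refine (add_le_add (map_add_le_add N2 _ _) le_rfl).trans ?_
    rw [hN2_CC, hN2_CX, l1Norm_X, l1Norm_X]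
    have h2 : N2 (Polynomial.C (Polynomial.C (X (Sum.inr (Sum.inr i)))) * Polynomial.X) ≤ 1 := by
      refine (map_mul_le_mul N2 _ _).trans ?_
      rw [hN2_CC, l1Norm_X]
      simpa using hN2_X
    push_cast
    linarith
  -- the image of `Q`
  have hQ : N2 (finTwoEquiv _ (planeSect Q)) ≤ 3 ^ Q.totalDegree * weight Q := by
    rw [finTwoEquiv_planeSect, MvPolynomial.aeval_def, MvPolynomial.eval₂_eq]
    have hN2one : N2 1 ≤ 1 := by
      rw [hN2, RingSeminorm.polynomial_apply, polyNorm_one]; exact hN1one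
    refine (polyNorm_sum_le N1 zero_le_one _ _).trans ?_
    rw [weight, Nat.cast_sum, Finset.mul_sum]
    refine Finset.sum_le_sum fun α hα => ?_
    rw [← RingSeminorm.polynomial_apply N1 1 zero_le_one, ← hN2]
    refine (map_mul_le_mul N2 _ _).trans ?_
    have hal : algebraMap ℤ (Polynomial (Polynomial (MvPolynomial (Params n) ℤ))) (coeff α Q) =
        Polynomial.C (Polynomial.C (C (coeff α Q))) :=
      RingHom.congr_fun (RingHom.ext_int (algebraMap ℤ _)
        (Polynomial.C.comp (Polynomial.C.comp (C : ℤ →+* MvPolynomial (Params n) ℤ)))) (coeff α Q)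
    rw [hal, hN2_CC, l1Norm_C, mul_comm]
    refine mul_le_mul_of_nonneg_right ?_ (Nat.cast_nonneg _)
    -- `N2 (∏ Tᵢ^{αᵢ}) ≤ 3^{|α|} ≤ 3^d`
    have hprod : N2 (α.prod fun i e => (Polynomial.C (Polynomial.C (X (Sum.inr (Sum.inl i)))) +
        Polynomial.C (Polynomial.C (X (Sum.inr (Sum.inr i)))) * Polynomial.X +
        Polynomial.C (Polynomial.C (X (Sum.inl i)) * Polynomial.X) :
          Polynomial (Polynomial (MvPolynomial (Params n) ℤ))) ^ e) ≤
        (3 : ℝ) ^ (∑ i ∈ α.support, α i) := by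
      rw [Finsupp.prod, hN2, RingSeminorm.polynomial_apply, ← Finset.prod_pow_eq_pow_sum]
      refine (polyNorm_prod_le N1 zero_le_one hN1one _ _).trans ?_
      refine Finset.prod_le_prod (fun i _ => polyNorm_nonneg N1 zero_le_one _) fun i _ => ?_
      refine (polyNorm_pow_le N1 zero_le_one hN1one _ _).trans ?_
      exact pow_le_pow_left₀ (polyNorm_nonneg N1 zero_le_one _)
        (by rw [← RingSeminorm.polynomial_apply N1 1 zero_le_one, ← hN2]; exact hgen i) _
    refine hprod.trans ?_
    exact_mod_cast Nat.pow_le_pow_right (by norm_num) (le_totalDegree hα)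
  -- the coefficient
  have hcoeff := coeff_coeff_finTwoEquiv _ (planeSect Q) (m 0) (m 1)
  have hm : Finsupp.single 0 (m 0) + Finsupp.single 1 (m 1) = m := by
    ext i; fin_cases i <;> simp
  rw [hm] at hcoeff
  have h1 : (l1Norm ((planeSect Q).coeff m) : ℝ) ≤ N2 (finTwoEquiv _ (planeSect Q)) := by
    rw [← hcoeff, ← l1Seminorm_apply]
    calc l1Seminorm (Params n) (((finTwoEquiv _ (planeSect Q)).coeff (m 0)).coeff (m 1))
        = l1Seminorm (Params n) (((finTwoEquiv _ (planeSect Q)).coeff (m 0)).coeff (m 1)) * 1 ^ (m 1) := by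
          rw [one_pow, mul_one]
      _ ≤ polyNorm (l1Seminorm (Params n)) 1 ((finTwoEquiv _ (planeSect Q)).coeff (m 0)) :=
          le_polyNorm _ zero_le_one _ _
      _ = N1 ((finTwoEquiv _ (planeSect Q)).coeff (m 0)) * 1 ^ (m 0) := by
          rw [hN1, RingSeminorm.polynomial_apply, one_pow, mul_one]
      _ ≤ polyNorm N1 1 (finTwoEquiv _ (planeSect Q)) := le_polyNorm _ zero_le_one _ _
      _ = N2 (finTwoEquiv _ (planeSect Q)) := by rw [hN2, RingSeminorm.polynomial_apply]
  exact_mod_cast h1.trans hQ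

/-! ## The entries of Ruppert's matrix of the section -/

/-- The coefficients of the section vanish above degree `deg Q`. -/
theorem coeff_planeSect_eq_zero (Q : MvPolynomial (Fin n) ℤ) {m : Fin 2 →₀ ℕ}
    (hm : Q.totalDegree < m.degree) : (planeSect Q).coeff m = 0 := by
  classical
  have hcoeff := coeff_coeff_finTwoEquiv _ (planeSect Q) (m 0) (m 1)
  have hm' : Finsupp.single 0 (m 0) + Finsupp.single 1 (m 1) = m := by
    ext i; fin_cases i <;> simp
  rw [hm', finTwoEquiv_planeSect, ← MvPolynomial.aeval_map_algebraMap (MvPolynomial (Params n) ℤ),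
    KaltofenGeneric.coeff_coeff_planeConst_eq_zero _ _ _ _ (m 0) (m 1)] at hcoeff
  · exact hcoeff.symm
  · refine lt_of_le_of_lt (Finset.sup_mono (support_map_subset _ _)) ?_
    rw [degree_fin_two] at hm
    change Q.totalDegree < m 1 + m 0
    omega

/-- `‖x · k‖₁ ≤ ‖x‖₁ · k` for a natural number `k`. -/
theorem l1Norm_mul_natCast_le {τ : Type*} (x : MvPolynomial τ ℤ) (k : ℕ) :
    l1Norm (x * (k : MvPolynomial τ ℤ)) ≤ l1Norm x * k := by
  refine (l1Norm_mul_le _ _).trans ?_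
  rw [← map_natCast (C : ℤ →+* MvPolynomial τ ℤ), l1Norm_C, Int.natAbs_natCast]

/-- One half of an entry: `‖[X^{e'}] (P ∂ᵢ X^e − X^e ∂ᵢ P)‖₁ ≤ 2 d · M₀` for any bound `M₀` of
the coefficients of `P = planeSect Q`, `d = deg Q`. -/
theorem l1Norm_coeff_entry_le (Q : MvPolynomial (Fin n) ℤ) (i : Fin 2) (e' : Fin 2 →₀ ℕ)
    {e : Fin 2 →₀ ℕ} (he : e.degree ≤ Q.totalDegree - 1) (M₀ : ℕ)
    (hM : ∀ m, l1Norm ((planeSect Q).coeff m) ≤ M₀) :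
    l1Norm (((planeSect Q) * pderiv i (monomial e 1) - monomial e 1 * pderiv i (planeSect Q)).coeff e') ≤
      2 * Q.totalDegree * M₀ := by
  classical
  have hei : e i ≤ Q.totalDegree := by
    have : e i ≤ e.degree := Finsupp.le_degree i e
    omega
  -- first term: `[X^{e'}] (P · eᵢ X^{e - 1ᵢ}) = eᵢ · [X^{e' - e + 1ᵢ}] P`
  have h1 : l1Norm (((planeSect Q) * pderiv i (monomial e 1)).coeff e') ≤ Q.totalDegree * M₀ := by
    rw [pderiv_monomial, one_mul, coeff_mul_monomial']
    by_cases hle : e - Finsupp.single i 1 ≤ e'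
    · rw [if_pos hle]
      calc l1Norm ((planeSect Q).coeff (e' - (e - Finsupp.single i 1)) * ((e i : ℕ) : MvPolynomial (Params n) ℤ))
            ≤ l1Norm ((planeSect Q).coeff (e' - (e - Finsupp.single i 1))) * e i := l1Norm_mul_natCast_le _ _
        _ ≤ M₀ * Q.totalDegree := Nat.mul_le_mul (hM _) hei
        _ = Q.totalDegree * M₀ := mul_comm _ _
    · rw [if_neg hle, l1Norm_zero]; exact Nat.zero_le _
  -- second term: `[X^{e'}] (X^e ∂ᵢ P) = (mᵢ + 1) [X^{m + 1ᵢ}] P`, `m = e' - e`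
  have h2 : l1Norm ((monomial e 1 * pderiv i (planeSect Q)).coeff e') ≤ Q.totalDegree * M₀ := by
    rw [coeff_monomial_mul']
    by_cases hle : e ≤ e'
    · rw [if_pos hle, one_mul, coeff_pderiv]
      by_cases hc : (planeSect Q).coeff (e' - e + Finsupp.single i 1) = 0
      · rw [hc, zero_mul, l1Norm_zero]; exact Nat.zero_le _
      · have hdeg : (e' - e + Finsupp.single i 1).degree ≤ Q.totalDegree := by
          by_contra hlt
          exact hc (coeff_planeSect_eq_zero Q (by omega))
        have hmi : (e' - e) i + 1 ≤ Q.totalDegree := by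
          have h3 : (e' - e) i ≤ (e' - e).degree := Finsupp.le_degree i (e' - e)
          rw [map_add, Finsupp.degree_single] at hdeg
          omega
        rw [← Nat.cast_succ]
        calc l1Norm ((planeSect Q).coeff (e' - e + Finsupp.single i 1) *
              (((e' - e) i + 1 : ℕ) : MvPolynomial (Params n) ℤ))
            ≤ l1Norm ((planeSect Q).coeff (e' - e + Finsupp.single i 1)) * ((e' - e) i + 1) :=
              l1Norm_mul_natCast_le _ _
          _ ≤ M₀ * Q.totalDegree := Nat.mul_le_mul (hM _) hmi
          _ = Q.totalDegree * M₀ := mul_comm _ _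
    · rw [if_neg hle, l1Norm_zero]; exact Nat.zero_le _
  have h3 := l1Norm_sub_le (((planeSect Q) * pderiv i (monomial e 1)).coeff e')
    ((monomial e 1 * pderiv i (planeSect Q)).coeff e')
  rw [← coeff_sub] at h3
  have h4 : Q.totalDegree * M₀ + Q.totalDegree * M₀ = 2 * Q.totalDegree * M₀ := by ring
  omega

/-- **The entries of Ruppert's matrix of the section**: `‖M(e', c)‖₁ ≤ 2 d · 3^d W`. -/
theorem l1Norm_rupMat_planeSect_le (Q : MvPolynomial (Fin n) ℤ) (e' : Fin 2 →₀ ℕ)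
    (c : Col Q.totalDegree) (M₀ : ℕ) (hM : ∀ m, l1Norm ((planeSect Q).coeff m) ≤ M₀) :
    l1Norm (rupMat Q.totalDegree (planeSect Q) e' c) ≤ 2 * Q.totalDegree * M₀ := by
  classical
  obtain ⟨t, e, he⟩ := c
  have he' : e.degree ≤ Q.totalDegree - 1 := mem_box.mp he
  unfold rupMat colPair
  fin_cases t
  · simp only [Fin.zero_eta, Fin.isValue, ↓reduceIte, rupOp, map_zero, mul_zero, sub_zero, zero_mul,
      add_zero]
    exact l1Norm_coeff_entry_le Q 1 e' he' M₀ hM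
  · simp only [Fin.mk_one, Fin.isValue, one_ne_zero, ↓reduceIte, rupOp, map_zero, mul_zero, zero_mul,
      sub_zero, zero_sub]
    rw [neg_add_eq_sub, ← neg_sub, coeff_neg, l1Norm_neg]
    exact l1Norm_coeff_entry_le Q 0 e' he' M₀ hM

/-! ## The size of a coefficient of a minor -/

/-- **The bad-prime budget of the minor.** For `Q` of total degree `d ≥ 1` and weight `W`, a minor
of Ruppert's matrix of `planeSect Q` of size `k ≤ N` has every integer coefficient `c` with
`log₂ |c| ≤ 16 · ((d + 1)(log₂ W + 1))⁴`. -/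
theorem log_coeff_rupMinor_le (Q : MvPolynomial (Fin n) ℤ) (hd : 1 ≤ Q.totalDegree) {k : ℕ}
    (hk : k ≤ Fintype.card (Col Q.totalDegree)) (rows : Fin k → (Fin 2 →₀ ℕ))
    (cs : Fin k → Col Q.totalDegree) (e : Params n →₀ ℕ) :
    Nat.log 2 ((rupMinor Q.totalDegree (planeSect Q) rows cs).coeff e).natAbs ≤
      16 * ((Q.totalDegree + 1) * (Nat.log 2 (weight Q) + 1)) ^ 4 := by
  classical
  obtain ⟨W, hW⟩ : ∃ W, weight Q = W := ⟨_, rfl⟩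
  obtain ⟨M₀, hM₀⟩ : ∃ M₀, 3 ^ Q.totalDegree * weight Q = M₀ := ⟨_, rfl⟩
  have hM : ∀ m, l1Norm ((planeSect Q).coeff m) ≤ M₀ := fun m => hM₀ ▸ l1Norm_coeff_planeSect_le Q m
  have hkN : k ≤ 2 * Q.totalDegree ^ 2 := hk.trans (card_Col_le hd)
  obtain ⟨d, hdd⟩ : ∃ d, Q.totalDegree = d := ⟨_, rfl⟩
  rw [hW, hdd] at hM₀
  rw [hdd] at hkN hd
  obtain ⟨E, hE⟩ : ∃ E, 2 * d * M₀ = E := ⟨_, rfl⟩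
  -- `|c| ≤ ‖Δ‖₁ ≤ k! E^k ≤ k^k E^k`
  have h1 : ((rupMinor Q.totalDegree (planeSect Q) rows cs).coeff e).natAbs ≤ k ^ k * E ^ k := by
    refine (natAbs_coeff_le_l1Norm _ _).trans ?_
    unfold rupMinor
    refine (l1Norm_det_le _ E fun i j => ?_).trans (Nat.mul_le_mul_right _ (Nat.factorial_le_pow k))
    rw [← hE, ← hdd]
    exact l1Norm_rupMat_planeSect_le Q _ _ M₀ hM
  have h2 := (Nat.log_mono_right h1).trans (log_two_pow_mul_pow_le k E k k)
  rw [hW]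
  set L := Nat.log 2 W with hL
  -- `log₂ k + 1 ≤ 2d² + 1`, `log₂ E + 1 ≤ 3d + L + 2`
  have hlogk : Nat.log 2 k + 1 ≤ 2 * d ^ 2 + 1 := by
    have : Nat.log 2 k ≤ k := Nat.log_le_self 2 k
    omega
  have hlogE : Nat.log 2 E + 1 ≤ 3 * d + L + 2 := by
    rcases Nat.eq_zero_or_pos W with hW0 | hWpos
    · have : E = 0 := by rw [← hE, ← hM₀, hW0]; ring
      rw [this, Nat.log_zero_right]; omega
    · have hEle : E ≤ 2 ^ (3 * d + (L + 1)) := by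
        have h2d : 2 * d ≤ 2 ^ d := by
          have h0 := Nat.lt_two_pow_self (n := d - 1)
          have h1 : 2 ^ d = 2 * 2 ^ (d - 1) := by
            rw [← pow_succ']; congr 1; omega
          omega
        have h3d : 3 ^ d ≤ 4 ^ d := Nat.pow_le_pow_left (by norm_num) d
        have hWl : W ≤ 2 ^ (L + 1) := (Nat.lt_pow_succ_log_self one_lt_two W).le
        calc E = 2 * d * (3 ^ d * W) := by rw [← hE, ← hM₀]
          _ ≤ 2 ^ d * (4 ^ d * 2 ^ (L + 1)) := Nat.mul_le_mul h2d (Nat.mul_le_mul h3d hWl)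
          _ = 2 ^ (3 * d + (L + 1)) := by
              rw [show (4 : ℕ) = 2 ^ 2 by norm_num, ← pow_mul, pow_add, pow_add, ← mul_assoc,
                ← pow_add]
              ring_nf
      have := Nat.log_mono_right (b := 2) hEle
      rw [Nat.log_pow one_lt_two] at this
      omega
  -- polynomial bookkeeping in `P₀ = (d + 1)(L + 1)`
  obtain ⟨P₀, hP₀⟩ : ∃ P₀, (d + 1) * (L + 1) = P₀ := ⟨_, rfl⟩
  have hdP : d + 1 ≤ P₀ := by rw [← hP₀]; exact Nat.le_mul_of_pos_right _ (by omega)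
  have hLP : L + 1 ≤ P₀ := by rw [← hP₀]; exact Nat.le_mul_of_pos_left _ (by omega)
  have hd2 : d ^ 2 ≤ P₀ ^ 2 := Nat.pow_le_pow_left (by omega) 2
  have hP1 : 1 ≤ P₀ ^ 2 := Nat.one_le_pow _ _ (by omega)
  have hA : k * (Nat.log 2 k + 1) ≤ 6 * P₀ ^ 4 := by
    calc k * (Nat.log 2 k + 1) ≤ 2 * d ^ 2 * (2 * d ^ 2 + 1) := Nat.mul_le_mul hkN hlogk
      _ ≤ 2 * P₀ ^ 2 * (3 * P₀ ^ 2) := Nat.mul_le_mul (Nat.mul_le_mul_left _ hd2) (by omega)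
      _ = 6 * P₀ ^ 4 := by ring
  have hB : k * (Nat.log 2 E + 1) ≤ 8 * P₀ ^ 4 := by
    calc k * (Nat.log 2 E + 1) ≤ 2 * d ^ 2 * (3 * d + L + 2) := Nat.mul_le_mul hkN hlogE
      _ ≤ 2 * P₀ ^ 2 * (4 * P₀) := Nat.mul_le_mul (Nat.mul_le_mul_left _ hd2) (by omega)
      _ = 8 * P₀ ^ 3 := by ring
      _ ≤ 8 * P₀ ^ 4 := Nat.mul_le_mul_left _ (Nat.pow_le_pow_right (by omega) (by norm_num))
  conv_rhs => rw [hdd, hP₀]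
  calc Nat.log 2 ((rupMinor Q.totalDegree (planeSect Q) rows cs).coeff e).natAbs
      ≤ k * (Nat.log 2 k + 1) + k * (Nat.log 2 E + 1) := h2
    _ ≤ 6 * P₀ ^ 4 + 8 * P₀ ^ 4 := Nat.add_le_add hA hB
    _ ≤ 16 * P₀ ^ 4 := by omega

end Summit.ValiantsHypothesis.ValiantsHypothesis.Theorems.LangWeilTransfer
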